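import Mathlib
import Summits.Ventures.PercRepro.TriangleCapLevelLocus
import Summits.Ventures.PercRepro.TriangleCapLayers

/-!
# PercRepro — THE EIGHTH-BEST LOCUS OF THE `K₄⁻`-FREE CHERRY TABLE, AND THE LAYER LOCUS ON THE CELL (p3, gen 50;
part 219)

* `cherry_eighth_best_locus` (`r ≥ 15`, `6 (r − 4) < stabGapFull k a r`): a graph at `closed − 6 (r − 4)` is
  `a`-bipartite, its missing graph has maximum degree `r − 3` at a vertex `w` and the three off-pairs form a star at a
  vertex `u`, each meeting `N(w)` in exactly one vertex (the `K_{2,3}` through `w`, or a `3`-star hung at a leaf).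
* `cherry_layer_locus` (general `t ≥ 2`): an `a`-bipartite graph whose missing graph has a vertex `w` of degree `r − t`
  at the vertex bound (gap `2 t (r − t − 1)`) has its `t` off-pairs forming a star at one vertex, each meeting `N(w)`.

Axioms: standard.
-/

namespace PercRepro

namespace TriangleCap

namespace C047

open Finset

/-- **THE LAYER LOCUS ON THE CELL:** an `a`-bipartite graph whose missing graph has a vertex `w` of degree `r − t`
(`t ≥ 2`, `w` not isolated in the missing graph) at the gap `2 t (r − t − 1)` has its `t` missing off-pairs forming a
star at a vertex `u`, each meeting the missing neighbourhood of `w` in exactly one vertex. -/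
theorem cherry_layer_locus (k a r t : ℕ) (hk : r + 1 ≤ k) (D : SimpleGraph (Fin k)) [DecidableRel D.Adj]
    (A : Finset (Fin k)) (hA : A.card = a) (hB : BipSub D A) (hm : D.edgeFinset.card + r = a * (k - a)) (w : Fin k)
    (hw : deg (missingGraph D A) w + t = r) (hw1 : 1 ≤ deg (missingGraph D A) w) (ht : 2 ≤ t)
    (heq : ∑ v, deg D v * deg D v + r * (k - 1 - r) + 2 * (t * (r - t - 1)) = D.edgeFinset.card * k) :
    ∃ u, (∀ e ∈ offEdges (missingGraph D A) w, u ∈ e) ∧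
      ∀ e ∈ offEdges (missingGraph D A) w, (univ.filter (fun v => (missingGraph D A).Adj w v ∧ v ∈ e)).card = 1 := by
  have hcard : Fintype.card (Fin k) = k := Fintype.card_fin k
  have hH := bipSub_sum_deg_sq_add_disjEdgePairs D A hB a r hA (by rw [hcard]; exact hm) (by rw [hcard]; exact hk)
  rw [hcard] at hH
  have hr : (missingGraph D A).edgeFinset.card = r := card_edges_missingGraph D A hB a r hA (by rw [hcard]; exact hm)
  have hid := sum_deg_sq_add_disjEdgePairs (missingGraph D A)
  rw [hr] at hid
  have hoff := card_offEdges_add_deg (missingGraph D A) w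
  rw [hr] at hoff
  have ht' : (offEdges (missingGraph D A) w).card = t := by omega
  have hS : ∑ v, deg (missingGraph D A) v * deg (missingGraph D A) v +
      2 * ((offEdges (missingGraph D A) w).card * (deg (missingGraph D A) w - 1)) = r * (r + 1) := by
    rw [ht']
    have e : deg (missingGraph D A) w - 1 = r - t - 1 := by omega
    rw [e]
    omega
  rw [← hr] at hS
  exact level_locus (missingGraph D A) (cliqueFree_of_bipSub _ A (bipSub_missingGraph D A)) w hw1 (by omega) hS

/-- **THE EIGHTH-BEST LOCUS:** for `3 ≤ a`, `15 ≤ r`, `2 a + r ≤ k` (`r + 7 ≤ k` at `a = 3`) and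
`6 (r − 4) < stabGapFull k a r`, every `K₄⁻`-free graph at `closed − 6 (r − 4)` is `a`-bipartite, its missing graph has
a vertex `w` of degree `r − 3`, and the three missing off-pairs form a star at a vertex `u`, each meeting the missing
neighbourhood of `w` in exactly one vertex. -/
theorem cherry_eighth_best_locus (k a r : ℕ) (ha3 : 3 ≤ a) (hr15 : 15 ≤ r) (hk : 2 * a + r ≤ k)
    (hk3 : a = 3 → r + 7 ≤ k) (hlt : 6 * (r - 4) < stabGapFull k a r) (D : SimpleGraph (Fin k))
    [DecidableRel D.Adj] (hK : K4mFree D) (hm : D.edgeFinset.card + r = a * (k - a))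
    (heq : ∑ v, deg D v * deg D v + r * (k - 1 - r) + 6 * (r - 4) = D.edgeFinset.card * k) :
    ∃ A : Finset (Fin k), A.card = a ∧ BipSub D A ∧
      ∃ w, deg (missingGraph D A) w + 3 = r ∧ (offEdges (missingGraph D A) w).card = 3 ∧
        ∃ u, (∀ e ∈ offEdges (missingGraph D A) w, u ∈ e) ∧
          ∀ e ∈ offEdges (missingGraph D A) w,
            (univ.filter (fun v => (missingGraph D A).Adj w v ∧ v ∈ e)).card = 1 := by
  have hcard : Fintype.card (Fin k) = k := Fintype.card_fin k
  have hbip : ∃ A : Finset (Fin k), A.card = a ∧ BipSub D A := by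
    by_contra hnb
    have h := (stab_table_rows_ge_three k a r ha3 hk (by omega) hk3).1 D hK hm hnb
    omega
  obtain ⟨A, hA, hB⟩ := hbip
  refine ⟨A, hA, hB, ?_⟩
  have hH := bipSub_sum_deg_sq_add_disjEdgePairs D A hB a r hA (by rw [hcard]; exact hm) (by rw [hcard]; omega)
  rw [hcard] at hH
  have hr : (missingGraph D A).edgeFinset.card = r := card_edges_missingGraph D A hB a r hA (by rw [hcard]; exact hm)
  have hid := sum_deg_sq_add_disjEdgePairs (missingGraph D A)
  rw [hr] at hid
  have hfree := cliqueFree_of_bipSub _ A (bipSub_missingGraph D A)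
  -- the maximum degree of the missing graph is `r − 3`
  obtain ⟨w, hwmax, hoff, j, hj, hlayer⟩ := pair_count_layer (missingGraph D A) hfree (by omega)
  rw [hr] at hoff hlayer
  obtain ⟨t, ht⟩ : ∃ t, (offEdges (missingGraph D A) w).card = t := ⟨_, rfl⟩
  rw [ht] at hoff hj hlayer
  have ht3 : t = 3 := by
    by_contra hne
    rcases Nat.lt_or_gt_of_ne hne with hlt3 | hgt3
    · -- `t ≤ 2`: the gap is at most `4 (r − 3) + 6 < 6 (r − 4)`
      interval_cases t
      · simp only [zero_mul, mul_zero, add_zero] at hlayer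
        omega
      · have e : deg (missingGraph D A) w - 1 = r - 2 := by omega
        rw [e, one_mul] at hlayer
        omega
      · have e : 2 * (deg (missingGraph D A) w - 1) = 2 * (r - 3) := by omega
        rw [e, ← mul_assoc] at hlayer
        omega
    · -- `t ≥ 4`: the level-three stability
      have hΔ : ∀ v, deg (missingGraph D A) v + 3 + 1 ≤ (missingGraph D A).edgeFinset.card := fun v => by
        have := hwmax v
        omega
      have := sum_deg_sq_le_of_maxdeg_level (missingGraph D A) hfree 3 (by omega) hΔ
      rw [hr] at this
      have e : 2 * ((3 + 1) * (r - 3 - 2)) = 8 * (r - 5) := by omega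
      rw [e] at this
      omega
  subst ht3
  refine ⟨w, by omega, ht, ?_⟩
  have hw1 : 1 ≤ deg (missingGraph D A) w := by omega
  have hS : ∑ v, deg (missingGraph D A) v * deg (missingGraph D A) v +
      2 * ((offEdges (missingGraph D A) w).card * (deg (missingGraph D A) w - 1)) =
      (missingGraph D A).edgeFinset.card * ((missingGraph D A).edgeFinset.card + 1) := by
    rw [ht, hr]
    have e : deg (missingGraph D A) w - 1 = r - 4 := by omega
    rw [e]
    omega
  exact level_locus (missingGraph D A) hfree w hw1 (by rw [ht]; norm_num) hS

end C047

end TriangleCap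

end PercRepro
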